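import Mathlib

/-!
# Tier4/Common/FundamentalDomainProdUniv — a fundamental domain with a FREE SECOND coordinate: `S ×ˢ univ` for a subgroup of
`H₁ × H₂` on which the first projection is injective, and the instance `Γ.prod ⊥` (the chain's `DZf ×ˢ univ`)

Blind re-derivation cell `pub-hodge-repro`, Tier 4 (README §9–§10), seat t4-typer-1 (gen 3).  Target tree path
`lean/Summits/Ventures/HodgeRepro/Tier4/Common/FundamentalDomainProdUniv.lean`.  Imports Mathlib only; the mirror image of
`FundamentalDomainProduct` (p695471, `univ ×ˢ S` with a free FIRST coordinate), not imported here.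

WHY: the unfolded unit of the Line-4 chain is `(νf ⊗ νf′)(suppSet γ₀ N γ₀ ∩ DZf ×ˢ univ)` on `T_f × T′_f` with `DZf` a fundamental
domain for `Z(k)` (L2-p2's `IsFundamentalDomain (centreFin W) DZf νf`) in the FIRST factor.  To apply `SaturationMeasure`
(p710190: `μ H = #(Γ ⊓ H) · μ (Γ · H ∩ D)`) on the product, `D := DZf ×ˢ univ` must be a fundamental domain for the subgroup
`Γ.prod ⊥ = Z(k) × 1` of `T_f × T′_f` for the product measure — which is what `isFundamentalDomain_prod_univ_of_prod_bot`
gives; `isFundamentalDomain_prod_univ` is the general statement for any `Z' ≤ H₁ × H₂` with `fst` injective on `Z'` and `S` a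
fundamental domain for `Z'.map fst`.  The three fields of Mathlib's `IsFundamentalDomain` by hand, exactly as in
`FundamentalDomainProduct` with the coordinates exchanged.

Nothing here says anything about the status of the Hodge conjecture for CM abelian varieties, which is NOT proved
(HC_CM is NOT proved by anyone in this repository).
-/

set_option autoImplicit false

noncomputable section

open MeasureTheory Measure Set Function
open scoped NNReal ENNReal Pointwise

namespace Summit.Ventures.HodgeRepro.Tier4.Common

section ProductLevel

variable {H₁ H₂ : Type*} [Group H₁] [MeasurableSpace H₁] [Group H₂] [MeasurableSpace H₂]

omit [MeasurableSpace H₁] [MeasurableSpace H₂] in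
/-- The translate of `S ×ˢ univ` by an element `v` of a subgroup of `H₁ × H₂` is `(v.1 • S) ×ˢ univ`. -/
theorem smul_prod_univ (Z' : Subgroup (H₁ × H₂)) (v : Z') (S : Set H₁) :
    v • (S ×ˢ (univ : Set H₂)) = ((v : H₁ × H₂).1 • S) ×ˢ (univ : Set H₂) := by
  ext p
  simp only [Subgroup.smul_def, smul_eq_mul, mem_smul_set, mem_prod, mem_univ, and_true]
  constructor
  · rintro ⟨q, hq, rfl⟩
    exact ⟨q.1, hq, rfl⟩
  · rintro ⟨a, ha, ha'⟩
    refine ⟨(a, (v : H₁ × H₂).2⁻¹ * p.2), ha, Prod.ext ?_ ?_⟩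
    · simpa only [Prod.fst_mul] using ha'
    · simp only [Prod.snd_mul, mul_inv_cancel_left]

/-- **A fundamental domain with a free second coordinate.**  If the first projection is injective on `Z' ≤ H₁ × H₂` and
`S` is a fundamental domain for the image `Z'.map fst` acting on `H₁`, then `S ×ˢ univ` is a fundamental domain for `Z'`
acting on `H₁ × H₂` (product measure, s-finite factors). -/
theorem isFundamentalDomain_prod_univ (Z' : Subgroup (H₁ × H₂)) (hinj : ∀ w ∈ Z', w.1 = 1 → w = 1)
    (ν₁ : Measure H₁) [SFinite ν₁] (ν₂ : Measure H₂) [SFinite ν₂]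
    (S : Set H₁) (hS : MeasurableSet S) (hfd : IsFundamentalDomain (Z'.map (MonoidHom.fst H₁ H₂)) S ν₁) :
    IsFundamentalDomain Z' (S ×ˢ (univ : Set H₂)) (ν₁.prod ν₂) where
  nullMeasurableSet := (hS.prod MeasurableSet.univ).nullMeasurableSet
  ae_covers := by
    have h1 := hfd.ae_covers
    rw [ae_iff] at h1 ⊢
    refine measure_mono_null (fun p hp => ?_)
      (show (ν₁.prod ν₂) ({a : H₁ | ¬ ∃ g : ↥(Z'.map (MonoidHom.fst H₁ H₂)), g • a ∈ S} ×ˢ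
        (univ : Set H₂)) = 0 by rw [prod_prod, h1, zero_mul])
    refine ⟨fun ⟨g, hg⟩ => hp ?_, mem_univ _⟩
    obtain ⟨w, hw, hwg⟩ := g.2
    refine ⟨⟨w, hw⟩, ?_, mem_univ _⟩
    show (w * p).1 ∈ S
    rw [Prod.fst_mul]
    have : w.1 = (g : H₁) := hwg
    rw [this]
    exact hg
  aedisjoint := by
    intro w w' hww'
    have h1 : (w : H₁ × H₂).1 ≠ (w' : H₁ × H₂).1 := by
      intro h
      apply hww'
      apply Subtype.ext
      have := hinj ((w : H₁ × H₂) * (w' : H₁ × H₂)⁻¹) (Z'.mul_mem w.2 (Z'.inv_mem w'.2))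
        (by rw [Prod.fst_mul, Prod.fst_inv, h, mul_inv_cancel])
      exact mul_inv_eq_one.1 this
    have hd := hfd.aedisjoint (show (⟨(w : H₁ × H₂).1, Subgroup.mem_map_of_mem _ w.2⟩ :
        ↥(Z'.map (MonoidHom.fst H₁ H₂))) ≠ ⟨(w' : H₁ × H₂).1, Subgroup.mem_map_of_mem _ w'.2⟩ from
      fun h => h1 (congrArg Subtype.val h))
    show (ν₁.prod ν₂) (w • (S ×ˢ (univ : Set H₂)) ∩ w' • (S ×ˢ (univ : Set H₂))) = 0
    rw [smul_prod_univ, smul_prod_univ, prod_inter_prod, univ_inter, prod_prod]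
    have : ν₁ ((w : H₁ × H₂).1 • S ∩ (w' : H₁ × H₂).1 • S) = 0 := hd
    rw [this, zero_mul]

omit [MeasurableSpace H₁] [MeasurableSpace H₂] in
/-- `(Γ.prod ⊥).map fst = Γ`. -/
theorem map_fst_prod_bot (Γ : Subgroup H₁) : (Γ.prod (⊥ : Subgroup H₂)).map (MonoidHom.fst H₁ H₂) = Γ := by
  ext x
  constructor
  · rintro ⟨w, hw, rfl⟩
    exact hw.1
  · intro hx
    exact ⟨(x, 1), ⟨hx, Subgroup.mem_bot.2 rfl⟩, rfl⟩

/-- **The instance `Γ × 1`**: if `S` is a fundamental domain for `Γ ≤ H₁` acting on `H₁`, then `S ×ˢ univ` is a fundamental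
domain for `Γ.prod ⊥ ≤ H₁ × H₂` acting on `H₁ × H₂` (the chain's `DZf ×ˢ univ` for `Z(k) × 1` on `T_f × T′_f`). -/
theorem isFundamentalDomain_prod_univ_of_prod_bot (Γ : Subgroup H₁) (ν₁ : Measure H₁) [SFinite ν₁]
    (ν₂ : Measure H₂) [SFinite ν₂] (S : Set H₁) (hS : MeasurableSet S) (hfd : IsFundamentalDomain Γ S ν₁) :
    IsFundamentalDomain (Γ.prod (⊥ : Subgroup H₂)) (S ×ˢ (univ : Set H₂)) (ν₁.prod ν₂) := by
  refine isFundamentalDomain_prod_univ (Γ.prod ⊥) ?_ ν₁ ν₂ S hS ?_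
  · rintro ⟨a, b⟩ ⟨-, hb⟩ h1
    have hb' : b = 1 := Subgroup.mem_bot.1 hb
    simp only at h1
    rw [h1, hb']
    rfl
  · rw [map_fst_prod_bot]
    exact hfd

end ProductLevel

end Summit.Ventures.HodgeRepro.Tier4.Common

end

/-!
## CORRECTION OF THE HEADER (v0.2, append-only; STATUS S15738, plan-4 S15751, crit-1 Entry 19 (C))

The header above (L9–L14) presents `DZf ×ˢ univ` as a fundamental domain for `Γ.prod ⊥ = Z(k) × 1` as the way to apply
`SaturationMeasure` on the product `T_f × T′_f` to the unfolded unit.  That route is WITHDRAWN: the support set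
`suppSet γ₀ N γ₀` is invariant under the DIAGONAL `Δ(Z(k))` only, and `(Z(k) × 1) · H ⊄ suppSet γ₀ N γ₀`.  The (β) unit of record
is (β1) `SaturationMeasure` on `T_f` ALONE (`Γ := centreFin W`, `D := DZf`, `H := Z⁰_f ⊔ levelTf N`, `E := Z_f · L_N`) composed
with (β2) the Fubini slice bound `Common/ProdSliceBound` (`prod_measure_inter_prod_univ_ge`).  The statements of this file are
unchanged and correct as theorems; `isFundamentalDomain_prod_univ` at `Z' := Δ(Z(k))` (the diagonal, `fst`-injective) with
`E := Δ(Z_f) · (L_N × L′_N)` is the valid product-level alternative recorded by crit-2 g9 (Entry 345).  Nothing here says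
anything about the status of the Hodge conjecture for CM abelian varieties, which is NOT proved (HC_CM is NOT proved by anyone
in this repository).
-/
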